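import Mathlib
import Literature.Analysis.FluidPDE.ClassicalSolutionProofs
import Literature.Analysis.FluidPDE.NSLerayHopfABCEnergyIdentity
import Literature.Analysis.FluidPDE.CaloricPairingIBP
import Literature.Analysis.FluidPDE.RapidDecayLemmas
import Literature.Analysis.FluidPDE.HydrodynamicImpulseRigidity
import HarnessLib

/-!
# Period moment laws of the rescaled Euler–Leray system, I: the ENERGY law
  (tools for item stmt-NavierStokesRegularity-1419, `EulerMelnikovDss.PeriodMomentLaws`)

Setting of the item: `ε > 0` and a classical solution `(W, q)` on `ℝ × ℝ³` of the Navier–Stokes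
system with viscosity `ε` and force `f(σ, y) = −(ε/2)(W(σ, y) + DW(σ, y) y)` — the rescaled
Euler–Leray system `∂_σ W + (W·∇)W + ∇q = ε(ΔW − ½(W + (y·∇)W))` — whose velocity is uniformly
rapidly decaying (`HasUniformRapidDecayOn univ W`).

* `pressure_linear_growth` — the pressure of such a solution grows at most linearly: the pressure
  gradient `∇q = εΔW − ∂_σW − (W·∇)W + f` is bounded (every term is), so
  `|q(σ, x)| ≤ |q(σ, 0)| + G |x|` (mean value inequality). This is the polynomial-growth hypothesis
  of the tree's energy identity `IsClassicalNSSolutionOn.hasDerivWithinAt_kineticEnergy_holds`.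
* `integral_inner_force_eq` — the work of the similarity drift:
  `∫ ⟪f, W⟫ = −(ε/2)(∫|W|² + ∫⟪W, DW y⟫) = (ε/4) ∫|W|²`, by the tree's
  `integral_inner_fderiv_apply_self_eq` (`∫ ⟪W, DW y⟫ = −(3/2)∫|W|²` in dimension `3`).
* `energy_law` — **law (iii) of the item, CORRECTLY PARENTHESISED**:
  `d/dσ ∫ |W|² = ε (½ (∫|W|²) − 2 ∫ |∇W|²_F)` at every `σ` (two-sided derivative on `univ`).
  READING NOTE for the planner: in the item's signature the third law is printed as
  `ε * ((1 / 2) * ∫ y, ‖W σ y‖ ^ 2 - 2 * ∫ y, frobeniusNormSq …)`, and Lean's integral binder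
  extends over the subtraction, i.e. it denotes `ε * ((1/2) * ∫ y, (‖W σ y‖² − 2·∫|∇W|²))` — a
  Bochner integral of a non-integrable function (a nonzero constant on `ℝ³`) whenever `∇W(σ) ≢ 0`,
  hence the junk value `0`; the typed law (iii) therefore asserts `d/dσ ∫|W|² = 0`, which is not the
  intended statement. The theorem below is the intended one; the item needs a re-parenthesised
  signature `ε * ((1 / 2) * (∫ y, ‖W σ y‖ ^ 2) - 2 * ∫ y, …)` before it can be closed.
* `impulse_law` — **law (i) of the item** (as typed): `d/dσ ∫ y × curl W = ε ∫ y × curl W`; in the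
  uniformly rapidly decaying velocity class both sides vanish identically (the tree's rigidity
  theorem `IsClassicalNSSolutionOn.integral_cross_vorticity_eq_zero_of_hasUniformRapidDecayOn`).

HONEST FRAMING: calculus identities about HYPOTHETICAL smooth rapidly decaying solutions of the
rescaled system; nothing here bears on NS regularity.
-/

noncomputable section

set_option linter.dupNamespace false

namespace Summit.NavierStokesRegularity.NavierStokesRegularity.Theorems

namespace PeriodMomentLaws

open MeasureTheory Set Filter Topology InnerProductSpace Literature.Analysis.FluidPDE
open scoped RealInnerProductSpace NNReal ENNReal ContDiff Laplacian

variable {ε : ℝ} {W : ℝ → EuclideanSpace ℝ (Fin 3) → EuclideanSpace ℝ (Fin 3)}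
  {q : ℝ → EuclideanSpace ℝ (Fin 3) → ℝ}

/-- `L²` membership from polynomial decay: a continuous `g` with `‖g x‖ ≤ C (1+‖x‖)^{-r}`, `r > 3/2`,
on `ℝ³`. [folklore] -/
theorem memLp_two_of_norm_le_rpow {G : Type*} [NormedAddCommGroup G]
    {g : EuclideanSpace ℝ (Fin 3) → G} (hg : Continuous g) {C r : ℝ} (hr : 3 / 2 < r)
    (h : ∀ x, ‖g x‖ ≤ C * (1 + ‖x‖) ^ (-r)) : MemLp g 2 volume := by
  rw [memLp_two_iff_integrable_sq_norm hg.aestronglyMeasurable]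
  refine integrable_of_norm_le_rpow_neg (hg.norm.pow 2) (C := C ^ 2) (r := 2 * r)
    (by rw [finrank_euclideanSpace_fin]; push_cast; linarith) fun x => ?_
  rw [Real.norm_eq_abs, abs_of_nonneg (sq_nonneg _)]
  have hC : 0 ≤ C * (1 + ‖x‖) ^ (-r) := (norm_nonneg _).trans (h x)
  calc ‖g x‖ ^ 2 ≤ (C * (1 + ‖x‖) ^ (-r)) ^ 2 := pow_le_pow_left₀ (norm_nonneg _) (h x) 2
    _ = C ^ 2 * (1 + ‖x‖) ^ (-(2 * r)) := by
        rw [mul_pow, ← Real.rpow_two ((1 + ‖x‖) ^ (-r)), ← Real.rpow_mul (by positivity)]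
        congr 1; ring_nf

/-- **The work of the similarity drift**: for a smooth field `V` on `ℝ³` with `V`, `DV` decaying
like `(1+|y|)^{-3}`, `∫ ⟪−(ε/2)(V + DV·y), V⟫ = (ε/4) ∫ |V|²`
(`∫ ⟪V, DV·y⟫ = −(3/2) ∫ |V|²`). [cite: MajdaBertozziCUP2002, §1.7 (Leray similarity drift; energy)] -/
theorem integral_inner_drift_eq {V : EuclideanSpace ℝ (Fin 3) → EuclideanSpace ℝ (Fin 3)}
    (hV : ContDiff ℝ ∞ V) {C : ℝ}
    (h0 : ∀ y, ‖V y‖ ≤ C * (1 + ‖y‖) ^ (-(3 : ℝ)))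
    (h1 : ∀ y, ‖fderiv ℝ V y‖ ≤ C * (1 + ‖y‖) ^ (-(3 : ℝ))) (ε : ℝ) :
    ∫ y, ⟪-((ε / 2) • (V y + fderiv ℝ V y y)), V y⟫ = ε / 4 * ∫ y, ‖V y‖ ^ 2 := by
  set b := stdOrthonormalBasis ℝ (EuclideanSpace ℝ (Fin 3)) with hb
  have hVc : Continuous V := hV.continuous
  have hDVc : Continuous (fderiv ℝ V) := hV.continuous_fderiv (by simp)
  have hC : 0 ≤ C := by
    have := (norm_nonneg _).trans (h0 0)
    simpa using this
  -- the weight `‖y‖ (1+‖y‖)^{-3} ≤ (1+‖y‖)^{-2}`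
  have hwt : ∀ y : EuclideanSpace ℝ (Fin 3),
      ‖y‖ * (1 + ‖y‖) ^ (-(3 : ℝ)) ≤ (1 + ‖y‖) ^ (-(2 : ℝ)) := fun y => by
    have h1 : 0 < 1 + ‖y‖ := by positivity
    rw [Real.rpow_neg h1.le, Real.rpow_neg h1.le, ← div_eq_mul_inv, div_le_iff₀ (by positivity),
      show (3 : ℝ) = 2 + 1 by norm_num, Real.rpow_add h1, Real.rpow_one]
    field_simp
    nlinarith [norm_nonneg y, Real.rpow_nonneg h1.le 2]
  -- `L²` memberships for `integral_inner_fderiv_apply_self_eq`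
  have hm0 : MemLp V 2 volume :=
    memLp_two_of_norm_le_rpow hVc (by norm_num) h0
  have hm1 : ∀ i, MemLp (fun y => fderiv ℝ V y (b i)) 2 volume := fun i =>
    memLp_two_of_norm_le_rpow (by fun_prop : Continuous fun y => fderiv ℝ V y (b i)) (r := 3)
      (C := C) (by norm_num) fun y => by
      calc ‖fderiv ℝ V y (b i)‖ ≤ ‖fderiv ℝ V y‖ * ‖b i‖ := ContinuousLinearMap.le_opNorm _ _
        _ = ‖fderiv ℝ V y‖ := by rw [b.orthonormal.1 i, mul_one]
        _ ≤ C * (1 + ‖y‖) ^ (-(3 : ℝ)) := h1 y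
  have hmw0 : ∀ i, MemLp (fun y => ⟪b i, y⟫ • V y) 2 volume := fun i =>
    memLp_two_of_norm_le_rpow (by fun_prop : Continuous fun y => ⟪b i, y⟫ • V y) (r := 2) (C := C)
      (by norm_num) fun y => by
      rw [norm_smul]
      calc ‖⟪b i, y⟫‖ * ‖V y‖ ≤ ‖y‖ * (C * (1 + ‖y‖) ^ (-(3 : ℝ))) := by
            refine mul_le_mul ?_ (h0 y) (norm_nonneg _) (norm_nonneg _)
            calc ‖⟪b i, y⟫‖ ≤ ‖b i‖ * ‖y‖ := norm_inner_le_norm _ _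
              _ = ‖y‖ := by rw [b.orthonormal.1 i, one_mul]
        _ = C * (‖y‖ * (1 + ‖y‖) ^ (-(3 : ℝ))) := by ring
        _ ≤ C * (1 + ‖y‖) ^ (-(2 : ℝ)) := mul_le_mul_of_nonneg_left (hwt y) hC
  have hmw1 : ∀ i, MemLp (fun y => ⟪b i, y⟫ • fderiv ℝ V y (b i)) 2 volume := fun i =>
    memLp_two_of_norm_le_rpow
      (by fun_prop : Continuous fun y => ⟪b i, y⟫ • fderiv ℝ V y (b i))
      (r := 2) (C := C) (by norm_num) fun y => by
      rw [norm_smul]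
      calc ‖⟪b i, y⟫‖ * ‖fderiv ℝ V y (b i)‖ ≤ ‖y‖ * (C * (1 + ‖y‖) ^ (-(3 : ℝ))) := by
            refine mul_le_mul ?_ ?_ (norm_nonneg _) (norm_nonneg _)
            · calc ‖⟪b i, y⟫‖ ≤ ‖b i‖ * ‖y‖ := norm_inner_le_norm _ _
                _ = ‖y‖ := by rw [b.orthonormal.1 i, one_mul]
            · calc ‖fderiv ℝ V y (b i)‖ ≤ ‖fderiv ℝ V y‖ * ‖b i‖ :=
                    ContinuousLinearMap.le_opNorm _ _
                _ = ‖fderiv ℝ V y‖ := by rw [b.orthonormal.1 i, mul_one]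
                _ ≤ C * (1 + ‖y‖) ^ (-(3 : ℝ)) := h1 y
        _ = C * (‖y‖ * (1 + ‖y‖) ^ (-(3 : ℝ))) := by ring
        _ ≤ C * (1 + ‖y‖) ^ (-(2 : ℝ)) := mul_le_mul_of_nonneg_left (hwt y) hC
  have hkey := AlbrittonBrueColombo2022.integral_inner_fderiv_apply_self_eq hV hm0 hm1 hmw0 hmw1
  rw [finrank_euclideanSpace_fin] at hkey
  -- integrability of the two pieces
  have hI0 : Integrable (fun y => ‖V y‖ ^ 2) :=
    (memLp_two_iff_integrable_sq_norm hm0.1).1 hm0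
  have hI1 : Integrable (fun y => ⟪V y, fderiv ℝ V y y⟫) := by
    refine integrable_of_norm_le_rpow_neg (by fun_prop : Continuous fun y => ⟪V y, fderiv ℝ V y y⟫)
      (C := C * C) (r := 5) (by rw [finrank_euclideanSpace_fin]; norm_num) fun y => ?_
    have hw3 : 0 ≤ (1 + ‖y‖) ^ (-(3 : ℝ)) := Real.rpow_nonneg (by positivity) _
    have e1 : ‖fderiv ℝ V y y‖ ≤ C * (1 + ‖y‖) ^ (-(2 : ℝ)) :=
      calc ‖fderiv ℝ V y y‖ ≤ ‖fderiv ℝ V y‖ * ‖y‖ := ContinuousLinearMap.le_opNorm _ _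
        _ ≤ C * (1 + ‖y‖) ^ (-(3 : ℝ)) * ‖y‖ :=
            mul_le_mul_of_nonneg_right (h1 y) (norm_nonneg _)
        _ = C * (‖y‖ * (1 + ‖y‖) ^ (-(3 : ℝ))) := by ring
        _ ≤ C * (1 + ‖y‖) ^ (-(2 : ℝ)) := mul_le_mul_of_nonneg_left (hwt y) hC
    calc ‖⟪V y, fderiv ℝ V y y⟫‖ ≤ ‖V y‖ * ‖fderiv ℝ V y y‖ := norm_inner_le_norm _ _
      _ ≤ C * (1 + ‖y‖) ^ (-(3 : ℝ)) * (C * (1 + ‖y‖) ^ (-(2 : ℝ))) :=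
          mul_le_mul (h0 y) e1 (norm_nonneg _) (mul_nonneg hC hw3)
      _ = C * C * ((1 + ‖y‖) ^ (-(3 : ℝ)) * (1 + ‖y‖) ^ (-(2 : ℝ))) := by ring
      _ = C * C * (1 + ‖y‖) ^ (-(5 : ℝ)) := by
          rw [← Real.rpow_add (by positivity)]; norm_num
  -- pointwise expansion of the integrand
  have hpt : ∀ y, ⟪-((ε / 2) • (V y + fderiv ℝ V y y)), V y⟫ =
      -(ε / 2) * ‖V y‖ ^ 2 + -(ε / 2) * ⟪V y, fderiv ℝ V y y⟫ := fun y => by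
    rw [inner_neg_left, real_inner_smul_left, inner_add_left, real_inner_self_eq_norm_sq,
      real_inner_comm (fderiv ℝ V y y)]
    ring
  simp_rw [hpt]
  rw [integral_add (hI0.const_mul _) (hI1.const_mul _), integral_const_mul, integral_const_mul,
    hkey]
  ring

/-- **The pressure of the rescaled system grows at most linearly.** For a classical solution
`(W, q)` on `ℝ × ℝ³` with uniformly rapidly decaying velocity and a force with bounded slices,
`∇q = νΔW − ∂_σW − (W·∇)W + f` is bounded on each slice, so `|q(σ, x)| ≤ C (1 + |x|)`.
[cite: MajdaBertozziCUP2002, §1.8 Prop. 1.16 (pressure from the momentum equation)] -/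
theorem pressure_linear_growth {ν : ℝ}
    {f : ℝ → EuclideanSpace ℝ (Fin 3) → EuclideanSpace ℝ (Fin 3)}
    (h : IsClassicalNSSolutionOn univ ν f W q) (hu : HasUniformRapidDecayOn univ W)
    {σ : ℝ} {B : ℝ} (hB : ∀ x, ‖f σ x‖ ≤ B) :
    ∃ (C : ℝ) (k : ℕ), ∀ x, |q σ x| ≤ C * (1 + ‖x‖) ^ k := by
  have hsm := h.smooth_velocity
  have hU : UniqueDiffOn ℝ (univ : Set ℝ) := uniqueDiffOn_univ
  obtain ⟨A0, hA0, hA0b⟩ := hu.norm_le_rpow 0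
  obtain ⟨A1, hA1, hA1b⟩ := hu.norm_fderiv_le_rpow hsm hU 0
  obtain ⟨A2, hA2, hA2b⟩ := hu.norm_fderiv_fderiv_le_rpow hsm hU 0
  obtain ⟨A3, hA3, hA3b⟩ := hu.norm_timeDerivWithin_le_rpow hsm hU 0
  have hw1 : ∀ x : EuclideanSpace ℝ (Fin 3), (1 + ‖x‖) ^ (-((0 : ℕ) : ℝ)) ≤ (1 : ℝ) := fun x =>
    rpow_neg_le_one x (Nat.cast_nonneg 0)
  have hv2 : ContDiff ℝ 2 (W σ) := (h.contDiff_velocity (mem_univ σ)).of_le (by norm_cast)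
  have hb0 : ∀ x, ‖W σ x‖ ≤ A0 := fun x =>
    (hA0b σ (mem_univ σ) x).trans (mul_le_of_le_one_right hA0 (hw1 x))
  have hb1 : ∀ x, ‖fderiv ℝ (W σ) x‖ ≤ A1 := fun x =>
    (hA1b σ (mem_univ σ) x).trans (mul_le_of_le_one_right hA1 (hw1 x))
  have hb2 : ∀ x, ‖fderiv ℝ (fderiv ℝ (W σ)) x‖ ≤ A2 := fun x =>
    (hA2b σ (mem_univ σ) x).trans (mul_le_of_le_one_right hA2 (hw1 x))
  have hb3 : ∀ x, ‖timeDerivWithin univ W σ x‖ ≤ A3 := fun x =>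
    (hA3b σ (mem_univ σ) x).trans (mul_le_of_le_one_right hA3 (hw1 x))
  -- bounded pressure gradient
  have hΔ : ∀ x, ‖(Δ (W σ)) x‖ ≤ 3 * A2 := fun x => by
    have := norm_laplacian_le_of_norm_fderiv_fderiv_le hv2 hb2 x
    rwa [finrank_euclideanSpace_fin, Nat.cast_ofNat] at this
  have hgrad : ∀ x, ‖gradient (q σ) x‖ ≤ |ν| * (3 * A2) + A3 + A1 * A0 + B := by
    intro x
    have hm := h.momentum σ (mem_univ σ) x
    have hpx : gradient (q σ) x = ν • (Δ (W σ)) x - timeDerivWithin univ W σ x -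
        convect (W σ) (W σ) x + f σ x := by
      rw [eq_sub_of_add_eq hm]; abel
    rw [hpx]
    have e1 : ‖ν • (Δ (W σ)) x‖ ≤ |ν| * (3 * A2) := by
      rw [norm_smul, Real.norm_eq_abs]; exact mul_le_mul_of_nonneg_left (hΔ x) (abs_nonneg ν)
    have e3 : ‖convect (W σ) (W σ) x‖ ≤ A1 * A0 := by
      rw [convect_apply]
      exact (ContinuousLinearMap.le_opNorm _ _).trans (mul_le_mul (hb1 x) (hb0 x) (norm_nonneg _) hA1)
    exact norm_add_le_of_le (norm_sub_le_of_le (norm_sub_le_of_le e1 (hb3 x)) e3) (hB x)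
  set G : ℝ := |ν| * (3 * A2) + A3 + A1 * A0 + B with hG
  -- mean value inequality from the origin
  have hqd : Differentiable ℝ (q σ) :=
    (h.contDiff_pressure (mem_univ σ)).differentiable (by simp)
  have hfd : ∀ x, ‖fderiv ℝ (q σ) x‖ ≤ G := fun x => by
    have := hgrad x
    rwa [gradient, LinearIsometryEquiv.norm_map] at this
  have hG0 : 0 ≤ G := (norm_nonneg _).trans (hgrad 0)
  refine ⟨|q σ 0| + G, 1, fun x => ?_⟩
  have hmv : ‖q σ x - q σ 0‖ ≤ G * ‖x - 0‖ :=
    Convex.norm_image_sub_le_of_norm_fderiv_le (𝕜 := ℝ) (f := q σ) (s := univ)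
      (fun y _ => hqd y) (fun y _ => hfd y) convex_univ (mem_univ 0) (mem_univ x)
  rw [sub_zero, Real.norm_eq_abs] at hmv
  have h1 : |q σ x| ≤ |q σ 0| + G * ‖x‖ := by
    have := abs_sub_abs_le_abs_sub (q σ x) (q σ 0); linarith
  have h2 : |q σ 0| + G * ‖x‖ ≤ (|q σ 0| + G) * (1 + ‖x‖) ^ (1 : ℕ) := by
    rw [pow_one]
    nlinarith [abs_nonneg (q σ 0), norm_nonneg x]
  exact h1.trans h2

/-- **Law (iii) of the item — the energy law of the rescaled Euler–Leray system**:
`d/dσ ∫ |W|² = ε (½ (∫ |W|²) − 2 ∫ |∇W|²_F)` (correctly parenthesised; see the module docstring for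
why the item's printed form is a junk integral). Proof: the tree's energy identity
`d/dσ (½∫|W|²) = −ε ∫|∇W|²_F + ∫⟪f, W⟫` (`hasDerivWithinAt_kineticEnergy_holds`, pressure of linear
growth by `pressure_linear_growth`) and the drift work `∫⟪f, W⟫ = (ε/4)∫|W|²`
(`integral_inner_drift_eq`). [cite: MajdaBertozziCUP2002, §1.7 Prop. 1.13 eq. (1.80)] -/
theorem energy_law (hε : 0 < ε)
    (h : IsClassicalNSSolutionOn univ ε (fun σ y => -((ε / 2) • (W σ y + fderiv ℝ (W σ) y y))) W q)
    (hu : HasUniformRapidDecayOn univ W) (σ : ℝ) :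
    HasDerivAt (fun s => ∫ y, ‖W s y‖ ^ 2)
      (ε * ((1 / 2) * (∫ y, ‖W σ y‖ ^ 2) - 2 * ∫ y, frobeniusNormSq (fderiv ℝ (W σ) y))) σ := by
  have hsm := h.smooth_velocity
  have hU : UniqueDiffOn ℝ (univ : Set ℝ) := uniqueDiffOn_univ
  obtain ⟨A0, hA0, hA0b⟩ := hu.norm_le_rpow 3
  obtain ⟨A1, hA1, hA1b⟩ := hu.norm_fderiv_le_rpow hsm hU 3
  obtain ⟨A4, hA4, hA4b⟩ := hu.norm_le_rpow 4
  set C : ℝ := A0 + A1 with hC_def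
  have hC : 0 ≤ C := by positivity
  have h0 : ∀ y, ‖W σ y‖ ≤ C * (1 + ‖y‖) ^ (-(3 : ℝ)) := fun y =>
    le_decay_of_le_decay y (by exact_mod_cast hA0b σ (mem_univ σ) y) (by rw [hC_def]; linarith)
  have h1 : ∀ y, ‖fderiv ℝ (W σ) y‖ ≤ C * (1 + ‖y‖) ^ (-(3 : ℝ)) := fun y =>
    le_decay_of_le_decay y (by exact_mod_cast hA1b σ (mem_univ σ) y) (by rw [hC_def]; linarith)
  have hV : ContDiff ℝ ∞ (W σ) := h.contDiff_velocity (mem_univ σ)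
  -- the force has bounded slices: `‖f σ y‖ ≤ (ε/2)(C + C)`
  have hwt : ∀ y : EuclideanSpace ℝ (Fin 3), ‖y‖ * (1 + ‖y‖) ^ (-(3 : ℝ)) ≤ 1 := fun y => by
    have h1 : 0 < 1 + ‖y‖ := by positivity
    rw [Real.rpow_neg h1.le, ← div_eq_mul_inv, div_le_one (by positivity)]
    have : (1 + ‖y‖) ^ (1 : ℝ) ≤ (1 + ‖y‖) ^ (3 : ℝ) :=
      Real.rpow_le_rpow_of_exponent_le (by linarith [norm_nonneg y]) (by norm_num)
    rw [Real.rpow_one] at this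
    linarith [norm_nonneg y]
  have hB : ∀ y, ‖-((ε / 2) • (W σ y + fderiv ℝ (W σ) y y))‖ ≤ ε / 2 * (C + C) := fun y => by
    rw [norm_neg, norm_smul, Real.norm_of_nonneg (by positivity)]
    refine mul_le_mul_of_nonneg_left ((norm_add_le _ _).trans (add_le_add ?_ ?_)) (by positivity)
    · exact (h0 y).trans (mul_le_of_le_one_right hC (rpow_neg_le_one y (by norm_num)))
    · calc ‖fderiv ℝ (W σ) y y‖ ≤ ‖fderiv ℝ (W σ) y‖ * ‖y‖ := ContinuousLinearMap.le_opNorm _ _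
        _ ≤ C * (1 + ‖y‖) ^ (-(3 : ℝ)) * ‖y‖ := by gcongr; exact h1 y
        _ = C * (‖y‖ * (1 + ‖y‖) ^ (-(3 : ℝ))) := by ring
        _ ≤ C := mul_le_of_le_one_right hC (hwt y)
  have hp := pressure_linear_growth h hu (σ := σ) hB
  -- integrability of the work `⟪f, W⟫`
  have hf : Integrable (fun y => ⟪-((ε / 2) • (W σ y + fderiv ℝ (W σ) y y)), W σ y⟫) := by
    have hVc : Continuous (W σ) := hV.continuous
    have hDVc : Continuous (fderiv ℝ (W σ)) := hV.continuous_fderiv (by simp)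
    refine integrable_of_norm_le_rpow_neg
      (by fun_prop : Continuous fun y => ⟪-((ε / 2) • (W σ y + fderiv ℝ (W σ) y y)), W σ y⟫)
      (C := ε / 2 * (C + C) * A4) (r := 4)
      (by rw [finrank_euclideanSpace_fin]; norm_num) fun y => ?_
    calc ‖⟪-((ε / 2) • (W σ y + fderiv ℝ (W σ) y y)), W σ y⟫‖
        ≤ ‖-((ε / 2) • (W σ y + fderiv ℝ (W σ) y y))‖ * ‖W σ y‖ := norm_inner_le_norm _ _
      _ ≤ ε / 2 * (C + C) * (A4 * (1 + ‖y‖) ^ (-(4 : ℝ))) :=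
          mul_le_mul (hB y) (by exact_mod_cast hA4b σ (mem_univ σ) y) (norm_nonneg _)
            (by positivity)
      _ = ε / 2 * (C + C) * A4 * (1 + ‖y‖) ^ (-(4 : ℝ)) := by ring
  -- the tree's energy identity, two-sided on `univ`
  have hkin := IsClassicalNSSolutionOn.hasDerivWithinAt_kineticEnergy_holds h convex_univ hu
    (mem_univ σ) hp hf
  rw [integral_inner_drift_eq hV h0 h1 ε] at hkin
  have hder : HasDerivAt (fun s => 2 * VectorCalculus.kineticEnergy (W s))
      (2 * (-ε * VectorCalculus.gradNormSq (W σ) + ε / 4 * ∫ y, ‖W σ y‖ ^ 2)) σ :=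
    (hkin.hasDerivAt (Filter.univ_mem)).const_mul 2
  have hfun : (fun s => 2 * VectorCalculus.kineticEnergy (W s)) = fun s => ∫ y, ‖W s y‖ ^ 2 := by
    funext s; simp only [VectorCalculus.kineticEnergy]; ring
  rw [hfun] at hder
  convert hder using 1
  simp only [VectorCalculus.gradNormSq]
  ring

/-- **Law (i) of the item — the impulse law** (as typed): `d/dσ ∫ y × curl W = ε ∫ y × curl W`.
In the uniformly rapidly decaying velocity class the impulse `∫ y × curl W(σ)` vanishes identically
(the tree's rigidity theorem, Saffman (3.2.13)+(3.2.15)), so both sides are `0`.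
[cite: Saffman1992, §3.2 eqs. (3.2.8), (3.2.13), (3.2.15)] -/
theorem impulse_law {ν : ℝ} {f : ℝ → EuclideanSpace ℝ (Fin 3) → EuclideanSpace ℝ (Fin 3)}
    (h : IsClassicalNSSolutionOn univ ν f W q) (hu : HasUniformRapidDecayOn univ W) (ε σ : ℝ) :
    HasDerivAt (fun s => ∫ y, cross y (curl (W s) y)) (ε • ∫ y, cross y (curl (W σ) y)) σ := by
  have hzero : ∀ s, ∫ y, cross y (curl (W s) y) = 0 := fun s =>
    h.integral_cross_vorticity_eq_zero_of_hasUniformRapidDecayOn uniqueDiffOn_univ hu (mem_univ s)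
  have hfun : (fun s => ∫ y, cross y (curl (W s) y)) = fun _ => (0 : EuclideanSpace ℝ (Fin 3)) :=
    funext hzero
  rw [hfun, hzero σ, smul_zero]
  exact hasDerivAt_const σ _

end PeriodMomentLaws

end Summit.NavierStokesRegularity.NavierStokesRegularity.Theorems

end
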